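import Literature.IUT.HodgeArakelov.GaloisPairCyclotomesBridge
import Literature.AnabelianGeometry.EtaleTheta.CyclotomeZHatAction
import HarnessLib

/-!
# Bridge B12 (twist component): the `Ẑ^×`-twist on `μ_Ẑ(G)` of [IUTchII] Cor. 1.11 is GENUINE

Mochizuki, *Inter-universal Teichmüller theory II*, §1, Corollary 1.11 (a) and Remark 1.11.1 (i)(b), kurims
manuscript (Dec. 2020) pp. 49–50 [claim: Mochizuki2012, status: disputed] (IUTchII §1 Cor 1.11, kurims p.49):
"the `Γ`-orbit [`Γ ⊆ Ẑ^×` a closed subgroup] of the cyclotomic rigidity isomorphism", "the natural action of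
`Ẑ^×`". Record-only typing under the claim key `Mochizuki2012` (D-0012, disputed); abc-iut cell, layer L6,
`plan/L6/MERGE-MAP.md` §8 row B12 (holder abc-iut-w4-d024), node `IUTchII:Cor1.11`.

`GaloisPairCyclotomesBridge.lean` (B12) inhabits abc-iut-L6-t1's `GaloisPairRigidityData` with the GENUINE
group-theoretic cyclotome `μ_Ẑ(G)` ([AbsTopIII] Cor. 1.10 (i)(a), abc-iut-L4-t1 `muZhat`) and leaves three named
inputs, among them `GalTwistInput S` — the `Ẑ^×`-action on `μ_Ẑ(G)`, natural in `G ≅ G*` — with only the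
DEGENERATE inhabitant `GalTwistInput.trivial`. `CyclotomeZHatAction.lean` constructs the classical `Ẑ^× = Aut(Ẑ)`
action on every cyclotome `Λ(A)` (`cyclotome.zhatTwist`, natural in `A`). This file DISCHARGES the input:

* `IsoClass.galCyclotomeTwist G : Ẑ^× →* Aut(μ_Ẑ(G))` — the genuine twist (`μ_Ẑ(G) = Λ(μ_{ℚ/ℤ}(G))`),
  `galCyclotomeTwist_apply_coe` (`(u · ζ)_n = ζ_n ^ χ_n(u)`), `galCyclotomeMap_twist` (NATURAL along `μ_Ẑ(f)`,
  PROVED from `cyclotome.map_zhatTwist`), `galCyclotomeTwist_smul` (commutes with the `G`-module structure =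
  the cyclotomic character of `G`, PROVED);
* `GalTwistInput.ofZHat S` — the GENUINE inhabitant of the twist input; hence the B12 instance of record with
  genuine `μ_Ẑ` AND genuine twist: `GaloisPairRigidityData.ofGaloisCyclotomeZHat R Y`, its `LDTransport`, the
  Cor. 1.11 functor `cor111FunctorGaloisZHat` (+ multiradiality), and the reading of the orbit (a):
  `orbitA Γ G = {χ(γ) ≫ (*bs-Gal) | γ ∈ Γ}` with `χ(γ)` the genuine action (`mem_orbitA_ofGaloisCyclotomeZHat_iff`).

Residual named inputs of the typed Cor. 1.11 over genuine data after this file: `GalRigidityInput A`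
([AbsTopIII] Rmk. 3.2.1 cyclotomic rigidity of the MLF-Galois pair — ties the abstract output interface `A` to
`G`) and `GalThetaSyncInput A` (`(l·Δ_Θ)` + [AbsTopIII] Cor. 1.10 (c), FACT-LIST F-0348 in the `CurveModel`
vocabulary). No named `Prop` fact; nothing of another seat edited or restated; nothing here bears on [IUTchIII]
Cor. 3.12; typed ≠ discharged.
-/

noncomputable section

namespace Literature.IUT.HodgeArakelov

open CategoryTheory
open Literature.AnabelianGeometry.AbsoluteAnabelian
open Literature.AnabelianGeometry.EtaleTheta (cyclotome)

universe u

/-! ## The genuine twist on `μ_Ẑ(G)` -/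

namespace IsoClass

variable {P : TopGroup.{u}} [CompactSpace P]

/-- **The `Ẑ^×`-twist on `μ_Ẑ(G)`** for an isomorph `G` of the compact group `P` ([IUTchII] Rmk. 1.11.1 (i)(b)
"the natural action of `Ẑ^×`"): the classical `Aut(Ẑ)`-action on the cyclotome `Λ(μ_{ℚ/ℤ}(G)) = μ_Ẑ(G)`
(`cyclotome.zhatTwist`), `(u · ζ)_n = ζ_n ^ χ_n(u)`. GENUINE (no input).
[claim: Mochizuki2012, status: disputed] (IUTchII §1 Rmk 1.11.1 (i), kurims p.50) -/
def galCyclotomeTwist (X : IsoClass P) : ZHatUnits →* MulAut X.galCyclotome :=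
  cyclotome.zhatTwist (Multiplicative (@muQZ X.G _ _ _ X.compactSpace_carrier))

/-- Components of the twist: `(u · ζ)_n = ζ_n ^ χ_n(u)` with `χ_n` the level-`n` cyclotomic character of
`Aut(Ẑ)`. [claim: Mochizuki2012, status: disputed] (IUTchII §1 Rmk 1.11.1 (i), kurims p.50) -/
theorem galCyclotomeTwist_apply_coe (X : IsoClass P) (u : ZHatUnits) (ζ : X.galCyclotome) (n : ℕ+) :
    (X.galCyclotomeTwist u ζ).1 n =
      ζ.1 n ^ (Literature.AnabelianGeometry.EtaleTheta.ZHatLevel.levelChar n u).val :=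
  rfl

/-- **Naturality of the twist along `μ_Ẑ(f)`** ([IUTchII] Cor. 1.11 (a): the `Γ`-orbit is functorial in
`G ≅ G*`): `μ_Ẑ(f) (u · ζ) = u · μ_Ẑ(f) ζ`. PROVED (`μ_Ẑ(f) = Λ(μ_{ℚ/ℤ}(f))` componentwise and `Λ(−)` is
`Ẑ^×`-equivariant, `cyclotome.map_zhatTwist`). [claim: Mochizuki2012, status: disputed]
(IUTchII §1 Cor 1.11, kurims p.49) -/
theorem galCyclotomeMap_twist {X Y : IsoClass P} (f : X ⟶ Y) (u : ZHatUnits) (ζ : X.galCyclotome) :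
    galCyclotomeMap f (X.galCyclotomeTwist u ζ) = Y.galCyclotomeTwist u (galCyclotomeMap f ζ) :=
  cyclotome.mapEquiv_zhatTwist_of_eq_map (galCyclotomeMap f)
    (AddMonoidHom.toMultiplicative
      (@muQZ.map X.G _ _ _ X.compactSpace_carrier Y.G _ _ _ Y.compactSpace_carrier (IsoClass.homIso f)))
    (fun _ => rfl) u ζ

/-- The twist COMMUTES with the `G`-module structure of `μ_Ẑ(G)` (abc-iut-L4-t1's conjugation action = the
cyclotomic character of `G`; [IUTchII] Rmk. 1.11.1 (i)(b): the `Ẑ^×`-automorphisms are "[`G`-linear]").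
PROVED (`cyclotome.smul_zhatTwist`). [claim: Mochizuki2012, status: disputed] (IUTchII §1 Rmk 1.11.1 (i), kurims p.50) -/
theorem galCyclotomeTwist_smul (X : IsoClass P) (g : X.G) (u : ZHatUnits) (ζ : X.galCyclotome) :
    haveI := X.compactSpace_carrier
    g • X.galCyclotomeTwist u ζ = X.galCyclotomeTwist u (g • ζ) := by
  haveI := X.compactSpace_carrier
  exact cyclotome.smul_zhatTwist g u ζ

end IsoClass

/-! ## The twist input of B12, GENUINE -/

variable {S : ThetaSetting.{u}}

/-- **`GalTwistInput` DISCHARGED**: the genuine `Ẑ^×`-twist on `μ_Ẑ(G)` with its naturality — an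
inhabitant of the B12 input structure built from `cyclotome.zhatTwist` (no hypothesis).
[claim: Mochizuki2012, status: disputed] (IUTchII §1 Cor 1.11, kurims p.49) -/
def GalTwistInput.ofZHat (S : ThetaSetting.{u}) [CompactSpace S.Gk] : GalTwistInput S where
  twist G := G.galCyclotomeTwist
  twist_natural f u x := IsoClass.galCyclotomeMap_twist f u x

/-- The twist of `GalTwistInput.ofZHat` is the genuine action (definitional).
[claim: Mochizuki2012, status: disputed] (IUTchII §1 Cor 1.11, kurims p.49) -/
theorem GalTwistInput.ofZHat_twist (S : ThetaSetting.{u}) [CompactSpace S.Gk] (G : IsoClass S.Gk) :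
    (GalTwistInput.ofZHat S).twist G = G.galCyclotomeTwist :=
  rfl

namespace GaloisPairRigidityData

variable [CompactSpace S.Gk] {A : AbsTopMonoids S}

/-- **B12 with genuine `μ_Ẑ` AND genuine twist**: t1's `GaloisPairRigidityData A` from the two remaining cited
inputs only — (a) the [AbsTopIII] Rmk. 3.2.1 rigidity isomorphism `R`, (b) the `(l·Δ_Θ)` / Cor. 1.10 (c) datum
`Y`. [claim: Mochizuki2012, status: disputed] (IUTchII §1 Cor 1.11, kurims p.49) -/
abbrev ofGaloisCyclotomeZHat (R : GalRigidityInput A) (Y : GalThetaSyncInput A) : GaloisPairRigidityData A :=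
  ofGaloisCyclotome (GalTwistInput.ofZHat S) R Y

/-- Its `Π`-transport (w5-d089's reduced `LDTransport`). [claim: Mochizuki2012, status: disputed]
(IUTchII §1 Cor 1.11, kurims p.49) -/
abbrev ofGaloisCyclotomeZHatLD (R : GalRigidityInput A) (Y : GalThetaSyncInput A) :
    (ofGaloisCyclotomeZHat R Y).LDTransport :=
  ofGaloisCyclotomeLD (GalTwistInput.ofZHat S) R Y

/-- **Reading of the orbit (a)** `(*bs-Gal_{G,⊳})` of the instance of record ([IUTchII] Cor. 1.11 (a) "the
`Γ`-orbit … of the cyclotomic rigidity isomorphism"): its members are EXACTLY the composites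
`χ(γ) ≫ (*bs-Gal)` of the GENUINE `Ẑ^×`-action by `γ ∈ Γ` with the rigidity isomorphism.
[claim: Mochizuki2012, status: disputed] (IUTchII §1 Cor 1.11, kurims p.49) -/
theorem mem_orbitA_ofGaloisCyclotomeZHat_iff (R : GalRigidityInput A) (Y : GalThetaSyncInput A)
    (Γ : Subgroup ZHatUnits) (G : IsoClass S.Gk) (φ : G.galCyclotome ≃* A.muZhatUnits G) :
    φ ∈ (ofGaloisCyclotomeZHat R Y).orbitA Γ G ↔
      ∃ γ ∈ Γ, φ = (G.galCyclotomeTwist γ).trans (R.bsGalTri G) :=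
  Iff.rfl

end GaloisPairRigidityData

/-- **IUTchII:Cor1.11 — the functor `ℛ → ℱ` of record over genuine `μ_Ẑ` with genuine twist** (kurims p. 49
ll. 36–44), modulo the two cited isomorphisms only. [claim: Mochizuki2012, status: disputed]
(IUTchII §1 Cor 1.11, kurims p.49) -/
abbrev cor111FunctorGaloisZHat [CompactSpace S.Gk] {A : AbsTopMonoids S} (R : GalRigidityInput A)
    (Y : GalThetaSyncInput A) (Γ : Subgroup ZHatUnits) (Γ' : Type u) [Group Γ'] :
    IsoClass S.PiX × TwistedIsoClass S.Gk Γ' ⥤ Cor111Tuple.{u} :=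
  cor111FunctorGalois (GalTwistInput.ofZHat S) R Y Γ Γ'

/-- … and "`Ψ_ℛ : ℛ → ℛ†` is multiradially defined" at it ([IUTchII] Cor. 1.11, p. 49 ll. 44–46).
[claim: Mochizuki2012, status: disputed] (IUTchII §1 Cor 1.11, kurims p.49) -/
theorem cor111FunctorGaloisZHat_multiradiallyDefined [CompactSpace S.Gk] {A : AbsTopMonoids S}
    (R : GalRigidityInput A) (Y : GalThetaSyncInput A) (Γ : Subgroup ZHatUnits) (Γ' : Type u) [Group Γ'] :
    ((ex18iii S Γ').toDagger (cor111FunctorGaloisZHat R Y Γ Γ')).IsMultiradiallyDefined :=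
  cor111FunctorGalois_multiradiallyDefined _ R Y Γ Γ'

/-- GIVEN only the constraining input (a) — the Rmk. 3.2.1 rigidity isomorphism — the typed Cor. 1.11 is
inhabited over genuine `μ_Ẑ` with genuine twist (tautological `Π`-datum).
[claim: Mochizuki2012, status: disputed] (IUTchII §1 Cor 1.11, kurims p.49) -/
theorem cor111FunctorGaloisZHat_multiradiallyDefined_of_rigidity [CompactSpace S.Gk] {A : AbsTopMonoids S}
    (R : GalRigidityInput A) (Γ : Subgroup ZHatUnits) (Γ' : Type u) [Group Γ'] :
    ((ex18iii S Γ').toDagger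
      (cor111FunctorGaloisZHat R (GalThetaSyncInput.tautological A) Γ Γ')).IsMultiradiallyDefined :=
  cor111FunctorGaloisZHat_multiradiallyDefined R _ Γ Γ'

end Literature.IUT.HodgeArakelov

end
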